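import Mathlib
import HarnessLib
import Summits.Langlands.Langlands.Theses.SkinnerWilesDefectOne
import Summits.Langlands.Langlands.Theorems.SkinnerWilesDefectOneSeedOfQuadraticBaseChangeOddPrimes
import Literature.NumberTheory.EllipticCurves.EisensteinNewformLevelRaisingProofs

/-!
# Item `SeedOfQuadraticBaseChange` (stmt-Langlands-15158, route `SkinnerWilesDefectOne`):
# the closing composition with the Gelbart dictionary fact DISCHARGED (six named facts left)

`…Theorems.SkinnerWilesDefectOneSeedOfQuadraticBaseChangeOddPrimes` (p95941) proves the item
`SeedOfQuadraticBaseChange : QuadraticBaseChangeGalois → EisensteinProModularSeed` for every odd `p`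
modulo SEVEN named facts `f₁ … f₅, e₁, e₂` and the open hypothesis `hgen'` (the seed crux VERBATIM on
GENUINE residual pairs — ratio not descending to an odd character of `Γ_ℚ`).  One of the seven,
`f₅ = Literature.NumberTheory.EllipticCurves.Gelbart1975_exists_cuspidalRepData_LAlgebraic` (newform
⇒ L-algebraic cuspidal datum with the Satake–Hecke dictionary; Gelbart 1975 Thm. 5.19), is a THEOREM
of the tree (`Gelbart1975_exists_cuspidalRepData_LAlgebraic_holds`,
`Literature/NumberTheory/EllipticCurves/EisensteinNewformLevelRaisingProofs.lean`), so it is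
discharged here: the descended regime (`seed_of_descends_of_quadraticBaseChangeGalois_sixFacts`) and
the item (`seedOfQuadraticBaseChange_of_genuineSeed_sixFacts`) hold modulo the SIX remaining named
facts — `f₁` Billerey–Menares 2016 Thm. 2.2 (odd `l`), `f₂` Hida 2000 Thm. 3.26 (1) (= Deligne's
`ℚ̄_p`-representation of a newform), `f₃` Thm. 3.26 (2) (ordinary frame with the unit root),
`f₄` Thm. 3.26 (3a) (inertia at the level, Carayol), `e₁` Eichler–Shimura–Harder existence for
cuspidal regular L-algebraic `Π` on `GL₂/F`, `e₂` algebraic-weight eigenclass ⇒ continuous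
`𝕋(𝒰)`-point — and `hgen'` alone.  No statement is weakened: the conclusions are literally those of
p95941; only the hypothesis `f₅` is gone.
-/

set_option linter.dupNamespace false -- project-wide option (lakefile weak.linter.dupNamespace); `Summit.Langlands.Langlands` is the mandated namespace

noncomputable section

namespace Summit.Langlands.Langlands.Theorems.SkinnerWilesDefectOne.SeedOfQuadraticBaseChange

open Summit.Langlands.Langlands.Theses.SkinnerWilesDefectOne
open Literature.NumberTheory.Automorphic Literature.NumberTheory.GaloisRepresentations
open Literature.NumberTheory.Automorphic.BigHeckeGLn
open NumberField IsDedekindDomain IsLocalRing Filter Field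

/-- **The odd-descended regime given quadratic base change, six named facts.**  Same statement as
`seed_of_descends_of_quadraticBaseChangeGalois` (p95941: `F` imaginary quadratic, `p ≠ 2`,
`O = 𝒪_{ℚ̄_p}`, `ρ₀` residually upper-triangular, a.e. unramified, `p`-distinguished at `v ∣ p`,
`η : Γ_ℚ → ℚ̄_pˣ` unit-valued with odd reduction descending the residual ratio ⇒ the seed's
conclusion for `ρ₀`), with the Gelbart dictionary fact supplied by the tree theorem
`Gelbart1975_exists_cuspidalRepData_LAlgebraic_holds` instead of being assumed. -/
theorem seed_of_descends_of_quadraticBaseChangeGalois_sixFacts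
    (hQ : QuadraticBaseChangeGalois)
    (f₁ : Literature.NumberTheory.EllipticCurves.BillereyMenares2016_thm22_exists_newform_odd)
    (f₂ : Literature.NumberTheory.EllipticCurves.Hida2000_thm326_exists_galoisRep)
    (f₃ : Literature.NumberTheory.EllipticCurves.Hida2000_thm326_ordinary_unitRoot)
    (f₄ : Literature.NumberTheory.EllipticCurves.Hida2000_thm326_inertia_of_level)
    (e₁ : Literature.NumberTheory.Automorphic.bianchi_cuspidal_regularLAlgebraic_eigenclassExists)
    (e₂ : Literature.NumberTheory.Automorphic.algebraicWeightEigenclass_continuousPoint)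
    (F : Type) [Field F] [NumberField F] (hF : IsTotallyComplex F) (hdeg : Module.finrank ℚ F = 2)
    (p : ℕ) [Fact p.Prime] (hp2 : p ≠ 2) (O : ValuationSubring (PadicAlgCl p))
    (hO : O = (Valued.v : Valuation (PadicAlgCl p) NNReal).valuationSubring)
    (ρ : FramedGaloisRep F (PadicAlgCl p) 2) (ρ₀ : absoluteGaloisGroup F →* Matrix.GeneralLinearGroup (Fin 2) O)
    (hunr : ∀ᶠ v in cofinite, ρ.IsUnramifiedAt v) (hmod : ρ.HasUpperTriangularIntegralModel ρ₀)
    (hdist : ∀ v : HeightOneSpectrum (𝓞 F), (p : 𝓞 F) ∈ v.asIdeal → IsPDistinguishedAt ρ₀ v)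
    (η : absoluteGaloisGroup ℚ →ₜ* (PadicAlgCl p)ˣ)
    (hU : ∀ τ, Valued.v ((η τ : (PadicAlgCl p)ˣ) : PadicAlgCl p) = 1)
    (hD : ∀ σ : absoluteGaloisGroup F,
      Valued.v (((η (absGaloisRestrict ℚ F σ) : (PadicAlgCl p)ˣ) : PadicAlgCl p) *
          ((ρ₀ σ).val 0 0 : PadicAlgCl p) - ((ρ₀ σ).val 1 1 : PadicAlgCl p)) < 1)
    (hodd : ∀ c : absoluteGaloisGroup ℚ, IsComplexConjugation (Rat.castHom ℝ) c →
      Valued.v (((η c : (PadicAlgCl p)ˣ) : PadicAlgCl p) + 1) < 1) :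
    ∃ (𝒰 : TameLevel 2 F p) (r : FramedGaloisRep F (PadicAlgCl p) 2)
      (r₀ : absoluteGaloisGroup F →* Matrix.GeneralLinearGroup (Fin 2) O)
      (q : HeightOneSpectrum (𝓞 F)),
      r.toGaloisRep.IsIrreducible ∧ 𝒰.IsPadicallyAutomorphic r ∧
      r.HasUpperTriangularIntegralModel r₀ ∧
      (∀ g, ((r₀ g).val 0 0 - (ρ₀ g).val 0 0 : O) ∈ maximalIdeal O ∧
        ((r₀ g).val 1 1 - (ρ₀ g).val 1 1 : O) ∈ maximalIdeal O) ∧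
      (∃ k : ℕ, 2 ≤ k ∧ ∃ m : ℕ, 0 < m ∧ ∀ v : HeightOneSpectrum (𝓞 F), (p : 𝓞 F) ∈ v.asIdeal →
        ∃ Q : Matrix.GeneralLinearGroup (Fin 2) (PadicAlgCl p),
          Valued.v (Q.val 0 0) ≤ Valued.v (Q.val 1 0) ∧
          ∀ σ, (Q⁻¹ * r.toLocal v σ * Q).val 1 0 = 0 ∧
            (σ ∈ absInertia (v.adicCompletion F) →
              (Q⁻¹ * r.toLocal v σ * Q).val 1 1 ^ m = 1 ∧
              (Q⁻¹ * r.toLocal v σ * Q).val 0 0 ^ m =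
                algebraMap (Padic p) (PadicAlgCl p)
                  (((GaloisRep.cyclotomicCharacter (v.adicCompletion F) p σ).val : PadicInt p) :
                    Padic p) ^ ((k - 1) * m))) ∧
      (∀ v : HeightOneSpectrum (𝓞 F), v ≠ q → (p : 𝓞 F) ∉ v.asIdeal →
        (∀ 𝔓 ∈ v.primesAbove, ∀ σ ∈ 𝔓.inertia (absoluteGaloisGroup F),
          ((ρ₀ σ).val 0 0 - 1 : O) ∈ maximalIdeal O ∧ ((ρ₀ σ).val 1 1 - 1 : O) ∈ maximalIdeal O) →
        v ∉ 𝒰.bad) :=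
  seed_of_descends_of_quadraticBaseChangeGalois hQ f₁ f₂ f₃ f₄
    Literature.NumberTheory.EllipticCurves.Gelbart1975_exists_cuspidalRepData_LAlgebraic_holds e₁ e₂ F hF
    hdeg p hp2 O hO ρ ρ₀ hunr hmod hdist η hU hD hodd

/-- **The item modulo GENUINE pairs, six named facts** (closing composition of stmt-Langlands-15158
for every odd `p`, conditional).  Same statement as `seedOfQuadraticBaseChange_of_genuineSeed`
(p95941) — granted `f₁ … f₄, e₁, e₂` (published theorems, Literature `def`s) and `hgen'` (the seed
crux `EisensteinProModularSeed` VERBATIM on residual pairs whose ratio does NOT descend to an odd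
continuous unit-valued character of `Γ_ℚ`; an explicit hypothesis, NOT a named fact: its truth is
unknown), `SeedOfQuadraticBaseChange` holds — with the seventh hypothesis of p95941, the Gelbart
dictionary fact, discharged by `Gelbart1975_exists_cuspidalRepData_LAlgebraic_holds`. -/
theorem seedOfQuadraticBaseChange_of_genuineSeed_sixFacts
    (f₁ : Literature.NumberTheory.EllipticCurves.BillereyMenares2016_thm22_exists_newform_odd)
    (f₂ : Literature.NumberTheory.EllipticCurves.Hida2000_thm326_exists_galoisRep)
    (f₃ : Literature.NumberTheory.EllipticCurves.Hida2000_thm326_ordinary_unitRoot)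
    (f₄ : Literature.NumberTheory.EllipticCurves.Hida2000_thm326_inertia_of_level)
    (e₁ : Literature.NumberTheory.Automorphic.bianchi_cuspidal_regularLAlgebraic_eigenclassExists)
    (e₂ : Literature.NumberTheory.Automorphic.algebraicWeightEigenclass_continuousPoint)
    (hgen' : ∀ (F : Type) [Field F] [NumberField F], NumberField.IsTotallyComplex F → Module.finrank ℚ F = 2 →
      ∀ (p : ℕ) [Fact p.Prime], p ≠ 2 → ∀ (O : ValuationSubring (PadicAlgCl p)),
      O = (Valued.v : Valuation (PadicAlgCl p) NNReal).valuationSubring →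
      ∀ (ρ : Literature.NumberTheory.GaloisRepresentations.FramedGaloisRep F (PadicAlgCl p) 2)
        (ρ₀ : Field.absoluteGaloisGroup F →* Matrix.GeneralLinearGroup (Fin 2) O),
      ρ.toGaloisRep.IsIrreducible → (∀ᶠ v in Filter.cofinite, ρ.IsUnramifiedAt v) →
      ρ.HasUpperTriangularIntegralModel ρ₀ →
      (∃ k : ℕ, 2 ≤ k ∧ ∃ m : ℕ, 0 < m ∧ ∀ v : IsDedekindDomain.HeightOneSpectrum (NumberField.RingOfIntegers F), (p : NumberField.RingOfIntegers F) ∈ v.asIdeal →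
        Literature.NumberTheory.GaloisRepresentations.IsPDistinguishedAt ρ₀ v ∧ ∃ Q : Matrix.GeneralLinearGroup (Fin 2) (PadicAlgCl p),
          Valued.v (Q.val 0 0) ≤ Valued.v (Q.val 1 0) ∧
          ∀ σ, (Q⁻¹ * ρ.toLocal v σ * Q).val 1 0 = 0 ∧
            (σ ∈ Literature.NumberTheory.GaloisRepresentations.absInertia (v.adicCompletion F) →
              (Q⁻¹ * ρ.toLocal v σ * Q).val 1 1 ^ m = 1 ∧
              (Q⁻¹ * ρ.toLocal v σ * Q).val 0 0 ^ m =
                algebraMap (Padic p) (PadicAlgCl p)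
                  (((Literature.NumberTheory.GaloisRepresentations.GaloisRep.cyclotomicCharacter (v.adicCompletion F) p σ).val : PadicInt p) :
                    Padic p) ^ ((k - 1) * m))) →
      ¬ (∃ η : Field.absoluteGaloisGroup ℚ →ₜ* (PadicAlgCl p)ˣ,
      (∀ τ, Valued.v ((η τ : (PadicAlgCl p)ˣ) : PadicAlgCl p) = 1) ∧
      (∀ σ : Field.absoluteGaloisGroup F,
        Valued.v (((η (Literature.NumberTheory.GaloisRepresentations.absGaloisRestrict ℚ F σ) : (PadicAlgCl p)ˣ) : PadicAlgCl p) *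
            ((ρ₀ σ).val 0 0 : PadicAlgCl p) - ((ρ₀ σ).val 1 1 : PadicAlgCl p)) < 1) ∧
      (∀ c : Field.absoluteGaloisGroup ℚ, Literature.NumberTheory.GaloisRepresentations.IsComplexConjugation (Rat.castHom ℝ) c →
        Valued.v (((η c : (PadicAlgCl p)ˣ) : PadicAlgCl p) + 1) < 1)) →
      ∃ (𝒰 : Literature.NumberTheory.Automorphic.BigHeckeGLn.TameLevel 2 F p) (r : Literature.NumberTheory.GaloisRepresentations.FramedGaloisRep F (PadicAlgCl p) 2)
        (r₀ : Field.absoluteGaloisGroup F →* Matrix.GeneralLinearGroup (Fin 2) O)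
        (q : IsDedekindDomain.HeightOneSpectrum (NumberField.RingOfIntegers F)),
        r.toGaloisRep.IsIrreducible ∧ 𝒰.IsPadicallyAutomorphic r ∧
        r.HasUpperTriangularIntegralModel r₀ ∧
        (∀ g, ((r₀ g).val 0 0 - (ρ₀ g).val 0 0 : O) ∈ IsLocalRing.maximalIdeal O ∧
          ((r₀ g).val 1 1 - (ρ₀ g).val 1 1 : O) ∈ IsLocalRing.maximalIdeal O) ∧
        (∃ k : ℕ, 2 ≤ k ∧ ∃ m : ℕ, 0 < m ∧ ∀ v : IsDedekindDomain.HeightOneSpectrum (NumberField.RingOfIntegers F), (p : NumberField.RingOfIntegers F) ∈ v.asIdeal →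
          ∃ Q : Matrix.GeneralLinearGroup (Fin 2) (PadicAlgCl p),
            Valued.v (Q.val 0 0) ≤ Valued.v (Q.val 1 0) ∧
            ∀ σ, (Q⁻¹ * r.toLocal v σ * Q).val 1 0 = 0 ∧
              (σ ∈ Literature.NumberTheory.GaloisRepresentations.absInertia (v.adicCompletion F) →
                (Q⁻¹ * r.toLocal v σ * Q).val 1 1 ^ m = 1 ∧
                (Q⁻¹ * r.toLocal v σ * Q).val 0 0 ^ m =
                  algebraMap (Padic p) (PadicAlgCl p)
                    (((Literature.NumberTheory.GaloisRepresentations.GaloisRep.cyclotomicCharacter (v.adicCompletion F) p σ).val : PadicInt p) :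
                      Padic p) ^ ((k - 1) * m))) ∧
        (∀ v : IsDedekindDomain.HeightOneSpectrum (NumberField.RingOfIntegers F), v ≠ q → (p : NumberField.RingOfIntegers F) ∉ v.asIdeal →
          (∀ 𝔓 ∈ v.primesAbove, ∀ σ ∈ 𝔓.inertia (Field.absoluteGaloisGroup F),
            ((ρ₀ σ).val 0 0 - 1 : O) ∈ IsLocalRing.maximalIdeal O ∧ ((ρ₀ σ).val 1 1 - 1 : O) ∈ IsLocalRing.maximalIdeal O) →
          v ∉ 𝒰.bad)) :
    SeedOfQuadraticBaseChange :=
  seedOfQuadraticBaseChange_of_genuineSeed f₁ f₂ f₃ f₄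
    Literature.NumberTheory.EllipticCurves.Gelbart1975_exists_cuspidalRepData_LAlgebraic_holds e₁ e₂ hgen'

end Summit.Langlands.Langlands.Theorems.SkinnerWilesDefectOne.SeedOfQuadraticBaseChange

end
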